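import Summits.ABC.IUTFork.LDHGenuinePrintIsmDecided
import Summits.ABC.IUTFork.LDHSlotResidue
import Literature.IUT.LogVolume.GenuineLogThetaUnionPerImageResidue
import HarnessLib

/-!
# The fork at [IUTchIII] Corollary 3.12, L-DH level, READING (U) over PRINT's (Ind2) BEYOND RATIONAL `j` (any `[F_mod : ℚ]`):
# the Θ-side is `−deĝ̲_lgp(P_Θ) + slotResidue(P_Θ)`, so the (U)-inequality holds IFF `gap − slotResidue ≤ ((l+5)/4)·log π`
# (abc-iut cell, row «C:UNION-PRINT-ISM-DEG2», KEY of C-R116 (a)(2); [IUTchIII] Cor. 3.12 p. 174; [IUTchIV] Thm. 1.10 Step (v) p. 27–28)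

Record-only PROOF file (D-0012; no definition, no `Prop` fact, no instance, no notation) of the abc-iut cell (seat abc-iut-c312-d1, gen 12;
sequel of «C:PERIMAGE-PRINT-ISM» parts 1/5/7: `LDHGenuinePrintIsmPacket` p509534, `LDHGenuineUnionPrintIsm` p515344, `LDHGenuinePrintIsmDecided`
p516974). TAKES NO SIDE on [IUTchIII] Cor. 3.12.

WHERE `[F_mod : ℚ] = 1` ENTERED. Part 7's criterion `ThetaVolumeInput.union_printInd2_iff_gap_le_arch_of_finrank_eq_one` rests on part 5's
`tΘ_norm_slotConstant_of_finrank_eq_one`: with ONE place of `F_mod` over each support prime the theta values along every collection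
`v⃗ ∈ V(F_mod)_p^{j+1}` have equal size, the (Ind1)-slot union `⋃_σ σ·O_𝕃(−P_Θ)_{v⃗∘σ} = ⋃_a ι_a(t_{j,v_a})·(R_I)^∼` collapses to the bare region and
the Θ-side is `−deĝ̲_lgp(P_Θ)`. THIS FILE removes the hypothesis. On the real packet slot-twists of DIFFERENT sizes are NESTED (this lineage's
`iota_smul_normalizedPacket_subset_of_norm_le`, `TensorPacketSlotTwists.lean`), so the slot union at `v⃗` is the twist by the LEAST DIVISIBLE theta
value of the collection; a print-dominated `H` (factorwise `Real.ismIsm` = unit homotheties, part 1's `forall_exists_unit_smul_of_printInd2`) moves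
nothing (`packetHull_iUnion_image_eq_of_forall_eq_smul`); hence `log μ̄_{v⃗} = max_a ln‖t_{j,v_a}‖ = −min_a θ_j(v_a)` and, summed with Dupuy–Hilado's
weights, the (U)-Θ-side over print's (Ind2) is EXACTLY `−ndegLgpSlotMin` = `−deĝ̲_lgp(P_Θ) + slotResidue(P_Θ; T(I))` — abc-iut-S8's (Ind1) slot
residue of `PilotSlotResidue.lean` (the weighted average of `θ_j(v⃗(j)) − min_k θ_j(v⃗(k)) ≥ 0`; `0` iff the pilot data are slot-constant on the
support primes, e.g. `[F_mod : ℚ] = 1`).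

* `realPrimePacketWith_lnνLp_hull_orbitH_slotUnion_eq_neg_slotMin_of_forall_eq_smul` — real packet (any local-field family, any shell), any
  family `H` of unit homotheties: `ln ν̄_{𝕃_p}(v⃗ ↦ hull(⋃_{g∈H} g(slot union))) = −(1/ℓ⋆)Σ_jΣ_{v⃗}(min_k θ_j(v⃗(k)))·Π_k Pr(v⃗(k))`;
* `localFields_lnνLp_hull_printInd2_slotUnion_eq_neg_slotMin` — the same on the GENUINE packet of a place section for every print-dominated `H`;
* **`ThetaVolumeInput.sum_lnνLp_hull_printInd2_union_eq_neg_ndegLgpSlotMin`** / **`…_eq_neg_ndegLgp_add_slotResidue`** — input level: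
  `Σ_{p∈T(I)} ln ν̄_{𝕃_p}((U)-region over H) = −ndegLgpSlotMin(P_Θ; T(I)) = −deĝ̲_lgp(P_Θ) + slotResidue(P_Θ; T(I))` (abc-iut-S8's
  `DHData.ndegLgpOn_eq_ndegLgp`);
* **`ThetaVolumeInput.union_printInd2_iff_gap_sub_slotResidue_le_arch`** — THE CRITERION, any `[F_mod : ℚ]`: the (U)-inequality over print's
  (Ind2) holds IFF `deĝ̲_lgp(P_Θ) − deĝ̲(P_q) − slotResidue ≤ ((l+5)/4)·log π` (so (P) ⟹ (U) over print's (Ind2), the residue being `≥ 0` —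
  abc-iut-S8's `slotResidue_nonneg` — and the converse fails by exactly the residue);
* **`Cor22.ThetaVolumeDatumAt.union_printInd2_iff_shallow_sub_slotResidue`** — at a genuine datum `T` of a `λ`-line point `P ∈ U` (ANY `d_mod`):
  (U) over print's (Ind2) ⟺ `((l+1)/24 − 1/(2l))·log q^{∤{2,l}}(λ) − slotResidue(T) ≤ ((l+5)/4)·log π` (`PointDict.gap_eq`); for `[F_mod : ℚ] = 1` the
  residue is `0` (abc-iut-S8's `slotResidue_eq_zero_of_finrank_eq_one`) and part 7 is recovered.

CENSUS WORDS (numbers about OUR typings; the C LEAD decides). «Beyond rational `j` the (U) reading over PRINT's (Ind2) is NOT a function of the two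
bare degrees: it is `gap − slotResidue(T) ≤ arch`, the residue being abc-iut-S8's (Ind1) slot residue of the datum's pilot data — positive exactly
when some support prime carries places of `F_mod` with theta values of unequal size (split primes with unequal pole orders, or a bad and a good place;
abc-iut-S7's `LDHSlotResidueSplitWitness`). At Broberg's quadratic point (`ℚ(√7)`; poles `𝔭₃ : 2`, `𝔭₃' : 24`, `𝔭₄₇ : 8`, both `3` and `47` split) the
residue is carried by `p = 3` (orders `2 | 24`) and `p = 47` (order `8 |` a good place); desk values (not kernel): residue `≈ 7.4` (`l = 7`), `≈ 12.6`
(`l = 11`) against `gap − arch ≈ 4.3`, `8.9` — so the (U) print-Ism reading would HOLD there while (P) fails (p511550); the kernel instantiation needs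
the transport `placesOver (fieldOfModuli T.E) p ≃ placesOver ℚ(√7) p` with weights and `ord(j_E)`, which the tree does not yet carry (reported).»

HONEST SCOPE: statements about OUR typing of print's (Ind2) (`Real.ismIsm`) and Dupuy–Hilado's (Ind1) (capsule permutations); decided-AS-TYPED ≠ in
print; (Ind1)'s strip part (abc-iut-c312-1 R17/R18), (Ind3), the log-link and [IUTchIII] Cor. 3.12 itself untouched; nothing here asserts the existence
of Θ-data, [IUTchIII] Cor. 3.12, [IUTchIV] Thm. 1.10, or abc; no side taken. [cite: Mochizuki2012, IUTchIII Cor. 3.12 p. 173–174; Thm. 3.11 (i) (Ind2)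
p. 154] [cite: Mochizuki2012, IUTchIV Thm. 1.10 Step (v) p. 27–28, Step (viii) p. 30] [cite: DupuyHilado2025, §3.6, §4.7, §4.9, §4.11, §4.12, Thm. 3.10.1]
[claim: Mochizuki2012, status: disputed] for every IUT quotation. Axioms: standard three.
-/

noncomputable section

open Set Module NumberField IsDedekindDomain
open scoped Pointwise TensorProduct

/-! ## 1. Real packet: the hull of the `H`-orbit of the slot union has `log μ̄ = −min_k θ` (least divisible slot) -/

namespace Literature.IUT.LogVolume

section RealPacketWith

variable {F : Type} [Field F] [NumberField F]
variable (p : ℕ) [Fact p.Prime] (𝔽 : LocalFields F p)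
variable (c : (j : ℕ) → (Fin (j + 1) → placesOver F p) → ℚ_[p]) (hc0 : ∀ j e, c j e ≠ 0)
  (hcσ : ∀ (j : ℕ) (τ : Equiv.Perm (Fin (j + 1))) (e : Fin (j + 1) → placesOver F p), c j (e ∘ τ) = c j e)

/-- **The (Ind1)-slot union IS the twist by the least divisible theta value of the collection**: on the real packet, for the degree `j = i+1` and a
collection `v⃗ = e`, if the slot `a` carries a theta value of maximal size then `⋃_σ σ·O_𝕃(−div t)_{v⃗∘σ} = ι_a(t_{i,v_a})·(R_I)^∼` (abc-iut-c312-3's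
`realPrimePacketWith_indOneUnion_pilotRegion_eq_slotUnion` + nestedness `iota_smul_normalizedPacket_subset_of_norm_le`).
[cite: Mochizuki2012, IUTchIV Thm. 1.10 Step (v) p. 27–28] [cite: DupuyHilado2025, §4.7] -/
theorem realPrimePacketWith_slotUnion_eq_iota_smul_of_forall_norm_le {lstar : ℕ}
    (t : Fin lstar → (v : placesOver F p) → (𝔽.k v)ˣ) (i : Fin lstar) (e : Fin ((i : ℕ) + 1 + 1) → placesOver F p)
    (a : Fin ((i : ℕ) + 1 + 1)) (ha : ∀ a', ‖(t i (e a') : 𝔽.k (e a'))‖ ≤ ‖(t i (e a) : 𝔽.k (e a))‖) :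
    (⋃ τ : Equiv.Perm (Fin ((i : ℕ) + 1 + 1)), (realPrimePacketWith p 𝔽 c hc0 hcσ).perm τ e ''
        (realPrimePacketWith p 𝔽 c hc0 hcσ).pilotRegion t ((i : ℕ) + 1) (e ∘ τ)) =
      iota p (fun b => 𝔽.k (e b)) a (t i (e a) : 𝔽.k (e a)) •
        (normalizedPacket p (fun b => 𝔽.k (e b)) : Set (PacketAlgebra p (fun b => 𝔽.k (e b)))) := by
  rw [realPrimePacketWith_indOneUnion_pilotRegion_eq_slotUnion]
  apply Set.Subset.antisymm
  · exact Set.iUnion_subset fun a' =>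
      iota_smul_normalizedPacket_subset_of_norm_le p (fun b => 𝔽.k (e b)) (DFac p (fun b => 𝔽.k (e b)))
        (dEquiv p (fun b => 𝔽.k (e b))) a' a (Units.ne_zero _) (ha a')
  · exact Set.subset_iUnion (fun a' => iota p (fun b => 𝔽.k (e b)) a' (t i (e a') : 𝔽.k (e a')) •
      (normalizedPacket p (fun b => 𝔽.k (e b)) : Set (PacketAlgebra p (fun b => 𝔽.k (e b))))) a

/-- **Per summand, over a family of unit homotheties**: `log μ̄_{v⃗}(hull(⋃_{g∈H} g(slot union))) = −min_k θ_i(v⃗(k))` when `ln‖t_{i,v}‖ = −θ_i(v)`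
(the `H`-orbit moves nothing: `packetHull_iUnion_image_eq_of_forall_eq_smul`; `log μ̄(ι_a(t)·(R_I)^∼) = ln‖t‖`, Dupuy–Hilado (3.7)).
[cite: DupuyHilado2025, §3.7, §4.9, §4.12] -/
theorem realPrimePacketWith_logμ_hull_orbitH_slotUnion_eq_neg_inf {lstar : ℕ}
    (t : Fin lstar → (v : placesOver F p) → (𝔽.k v)ˣ)
    (θ : Fin lstar → placesOver F p → ℝ) (hθ : ∀ i v, Real.log ‖(t i v : 𝔽.k v)‖ = -θ i v)
    (i : Fin lstar) (e : Fin ((i : ℕ) + 1 + 1) → placesOver F p)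
    (H : Subgroup (PacketAlgebra p (fun b => 𝔽.k (e b)) ≃ₗ[ℚ_[p]] PacketAlgebra p (fun b => 𝔽.k (e b))))
    (hH : ∀ g ∈ H, ∃ u : ℚ_[p], ‖u‖ = 1 ∧
      ∀ x, (g : PacketAlgebra p (fun b => 𝔽.k (e b)) ≃ₗ[ℚ_[p]] PacketAlgebra p (fun b => 𝔽.k (e b))) x = u • x) :
    (realPrimePacketWith p 𝔽 c hc0 hcσ).logμ
        (packetHull p (fun b => 𝔽.k (e b))
          (⋃ g : H, (g : PacketAlgebra p (fun b => 𝔽.k (e b)) ≃ₗ[ℚ_[p]] PacketAlgebra p (fun b => 𝔽.k (e b))) ''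
            ⋃ τ : Equiv.Perm (Fin ((i : ℕ) + 1 + 1)), (realPrimePacketWith p 𝔽 c hc0 hcσ).perm τ e ''
              (realPrimePacketWith p 𝔽 c hc0 hcσ).pilotRegion t ((i : ℕ) + 1) (e ∘ τ))) =
      -(Finset.univ.inf' Finset.univ_nonempty (fun k => θ i (e k))) := by
  obtain ⟨a, -, ha⟩ := Finset.exists_max_image Finset.univ (fun a => ‖(t i (e a) : 𝔽.k (e a))‖) Finset.univ_nonempty
  have hS := realPrimePacketWith_slotUnion_eq_iota_smul_of_forall_norm_le p 𝔽 c hc0 hcσ t i e a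
    (fun a' => ha a' (Finset.mem_univ _))
  have hU : (⋃ g : H, (g : PacketAlgebra p (fun b => 𝔽.k (e b)) ≃ₗ[ℚ_[p]] PacketAlgebra p (fun b => 𝔽.k (e b))) ''
        ⋃ τ : Equiv.Perm (Fin ((i : ℕ) + 1 + 1)), (realPrimePacketWith p 𝔽 c hc0 hcσ).perm τ e ''
          (realPrimePacketWith p 𝔽 c hc0 hcσ).pilotRegion t ((i : ℕ) + 1) (e ∘ τ)) =
      ⋃ g : H, (g : PacketAlgebra p (fun b => 𝔽.k (e b)) ≃ₗ[ℚ_[p]] PacketAlgebra p (fun b => 𝔽.k (e b))) ''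
        (iota p (fun b => 𝔽.k (e b)) a (t i (e a) : 𝔽.k (e a)) •
          (normalizedPacket p (fun b => 𝔽.k (e b)) : Set (PacketAlgebra p (fun b => 𝔽.k (e b))))) :=
    Set.iUnion_congr fun g => congrArg
      (fun S => (g : PacketAlgebra p (fun b => 𝔽.k (e b)) ≃ₗ[ℚ_[p]] PacketAlgebra p (fun b => 𝔽.k (e b))) '' S) hS
  show packetLogμ p (fun b => 𝔽.k (e b)) (packetHull p (fun b => 𝔽.k (e b)) _) = _
  rw [hU, packetHull_iUnion_image_eq_of_forall_eq_smul p (fun b => 𝔽.k (e b)) H hH]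
  rw [packetLogμ_iota_smul_normalizedPacket p (fun b => 𝔽.k (e b)) a (Units.ne_zero _), hθ]
  congr 1
  refine le_antisymm (Finset.le_inf' _ _ fun k _ => ?_) (Finset.inf'_le _ (Finset.mem_univ a))
  have hk : Real.log ‖(t i (e k) : 𝔽.k (e k))‖ ≤ Real.log ‖(t i (e a) : 𝔽.k (e a))‖ :=
    Real.log_le_log (norm_pos_iff.mpr (Units.ne_zero _)) (ha k (Finset.mem_univ _))
  rw [hθ, hθ] at hk
  linarith

/-- **`ln ν̄_{𝕃_p}` of the hull of the `H`-orbit of the slot union = −(the least-slot aggregate at `p`)**: for the real packet (any local-field family,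
any shell normalisation), a `p`-local idele `t` with `ln‖t_{i,v}‖ = −θ_i(v)` and any family `H` of unit homotheties:
`ln ν̄_{𝕃_p}(v⃗ ↦ hull(⋃_{g∈H} g(⋃_σ σ·O_𝕃(−div t)))) = −(1/ℓ⋆)Σ_iΣ_{v⃗}(min_k θ_i(v⃗(k)))·Π_k Pr(v⃗(k))`. [cite: DupuyHilado2025, Def. 3.6.3, §4.7, §4.12]
[cite: Mochizuki2012, IUTchIV Thm. 1.10 Step (v) p. 27–28] -/
theorem realPrimePacketWith_lnνLp_hull_orbitH_slotUnion_eq_neg_slotMin_of_forall_eq_smul {lstar : ℕ}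
    (t : Fin lstar → (v : placesOver F p) → (𝔽.k v)ˣ)
    (θ : Fin lstar → placesOver F p → ℝ) (hθ : ∀ i v, Real.log ‖(t i v : 𝔽.k v)‖ = -θ i v)
    (H : (j : ℕ) → (e : Fin (j + 1) → placesOver F p) →
      Subgroup (PacketAlgebra p (fun b => 𝔽.k (e b)) ≃ₗ[ℚ_[p]] PacketAlgebra p (fun b => 𝔽.k (e b))))
    (hH : ∀ j e, ∀ g ∈ H j e, ∃ u : ℚ_[p], ‖u‖ = 1 ∧
      ∀ x, (g : PacketAlgebra p (fun b => 𝔽.k (e b)) ≃ₗ[ℚ_[p]] PacketAlgebra p (fun b => 𝔽.k (e b))) x = u • x) :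
    (realPrimePacketWith p 𝔽 c hc0 hcσ).lnνLp lstar (fun j e =>
        packetHull p (fun b => 𝔽.k (e b))
          (⋃ g : H j e, (g : PacketAlgebra p (fun b => 𝔽.k (e b)) ≃ₗ[ℚ_[p]] PacketAlgebra p (fun b => 𝔽.k (e b))) ''
            ⋃ τ : Equiv.Perm (Fin (j + 1)), (realPrimePacketWith p 𝔽 c hc0 hcσ).perm τ e ''
              (realPrimePacketWith p 𝔽 c hc0 hcσ).pilotRegion t j (e ∘ τ))) =
      -((1 / (lstar : ℝ)) * ∑ i : Fin lstar, ∑ e : Fin ((i : ℕ) + 1 + 1) → placesOver F p,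
          Finset.univ.inf' Finset.univ_nonempty (fun k => θ i (e k)) * ∏ k, weight F (e k).1) := by
  unfold PrimePacket.lnνLp PrimePacket.lnνTensorPower
  rw [← mul_neg, ← Finset.sum_neg_distrib]
  congr 1
  refine Finset.sum_congr rfl fun i _ => ?_
  rw [← Finset.sum_neg_distrib]
  refine Finset.sum_congr rfl fun e _ => ?_
  rw [← neg_mul]
  congr 1
  exact realPrimePacketWith_logμ_hull_orbitH_slotUnion_eq_neg_inf p 𝔽 c hc0 hcσ t θ hθ i e (H _ e) (hH _ e)

end RealPacketWith

end Literature.IUT.LogVolume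

/-! ## 2. The genuine packet of a place section: print-dominated families -/

namespace Summit.ABC.IUTFork

open Literature.IUT.LogVolume Literature.NumberTheory.NumberFields Thm311.Real

section GenuinePacket

variable {F₀ : Type} [Field F₀] [NumberField F₀] {K : Type} [Field K] [NumberField K] [Algebra F₀ K]
variable (σ : PlaceSection F₀ K) (p : ℕ) [hp : Fact p.Prime]
variable (c : (j : ℕ) → (Fin (j + 1) → placesOver F₀ p) → ℚ_[p]) (hc0 : ∀ j e, c j e ≠ 0)
  (hcσ : ∀ (j : ℕ) (τ : Equiv.Perm (Fin (j + 1))) (e : Fin (j + 1) → placesOver F₀ p), c j (e ∘ τ) = c j e)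

/-- **READING (U) OVER PRINT's (Ind2) IS THE LEAST-SLOT VALUE**, on the genuine packet `X_{v⃗} = ⊗_b K_{v̲_b}` of a place section, for every family
`H` DOMINATED BY PRINT's (Ind2) (factorwise abc-iut-c312-1 `Real.ismIsm (analyticLogv K) v̲_b`; unit homotheties by part 1's
`forall_exists_unit_smul_of_printInd2`): `ln ν̄_{𝕃_p}((U)-region over H) = −(1/ℓ⋆)Σ_iΣ_{v⃗}(min_k θ_i(v⃗(k)))·Π_k Pr(v⃗(k))`.
[cite: Mochizuki2012, IUTchIII Cor. 3.12 p. 174; Thm. 3.11 (i) (Ind2) p. 154] [cite: DupuyHilado2025, §4.7, §4.9, §4.12] [claim: Mochizuki2012, status: disputed] -/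
theorem localFields_lnνLp_hull_printInd2_slotUnion_eq_neg_slotMin {lstar : ℕ}
    (t : Fin lstar → (v : placesOver F₀ p) → ((σ.localFields p).k v)ˣ)
    (θ : Fin lstar → placesOver F₀ p → ℝ) (hθ : ∀ i v, Real.log ‖(t i v : (σ.localFields p).k v)‖ = -θ i v)
    (H : (j : ℕ) → (e : Fin (j + 1) → placesOver F₀ p) →
      Subgroup (PacketAlgebra p (fun b => (σ.localFields p).k (e b)) ≃ₗ[ℚ_[p]]
        PacketAlgebra p (fun b => (σ.localFields p).k (e b))))
    (hH : ∀ j e, ∀ g ∈ H j e,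
      ∃ ψ : ∀ b : Fin (j + 1), Carrier (.inr (σ.lift (e b).1) : Thm311.Real.Place K) ≃ₗ[ℚ]
          Carrier (.inr (σ.lift (e b).1) : Thm311.Real.Place K),
        (∀ b, ψ b ∈ ismIsm (analyticLogv K) (σ.lift (e b).1)) ∧
        ∀ x : ∀ b, (σ.localFields p).k (e b),
          (g : PacketAlgebra p (fun b => (σ.localFields p).k (e b)) ≃ₗ[ℚ_[p]]
              PacketAlgebra p (fun b => (σ.localFields p).k (e b))) (PiTensorProduct.tprod ℚ_[p] x) =
            PiTensorProduct.tprod ℚ_[p] (fun b =>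
              RescaledCompletion.of K p (σ.lift (e b).1) (σ.natCast_mem_lift (e b))
                (ψ b ((RescaledCompletion.of K p (σ.lift (e b).1) (σ.natCast_mem_lift (e b))).symm (x b))))) :
    (realPrimePacketWith p (σ.localFields p) c hc0 hcσ).lnνLp lstar (fun j e =>
        packetHull p (fun b => (σ.localFields p).k (e b))
          (⋃ g : H j e, (g : PacketAlgebra p (fun b => (σ.localFields p).k (e b)) ≃ₗ[ℚ_[p]]
              PacketAlgebra p (fun b => (σ.localFields p).k (e b))) ''
            ⋃ τ : Equiv.Perm (Fin (j + 1)), (realPrimePacketWith p (σ.localFields p) c hc0 hcσ).perm τ e ''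
              (realPrimePacketWith p (σ.localFields p) c hc0 hcσ).pilotRegion t j (e ∘ τ))) =
      -((1 / (lstar : ℝ)) * ∑ i : Fin lstar, ∑ e : Fin ((i : ℕ) + 1 + 1) → placesOver F₀ p,
          Finset.univ.inf' Finset.univ_nonempty (fun k => θ i (e k)) * ∏ k, weight F₀ (e k).1) :=
  realPrimePacketWith_lnνLp_hull_orbitH_slotUnion_eq_neg_slotMin_of_forall_eq_smul p (σ.localFields p) c hc0 hcσ t θ hθ H
    (forall_exists_unit_smul_of_printInd2 σ p H hH)

end GenuinePacket

end Summit.ABC.IUTFork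

/-! ## 3. Input level: the (U)-Θ-side over print's (Ind2) is `−deĝ̲_lgp(P_Θ) + slotResidue`; THE CRITERION -/

namespace Literature.IUT.LogVolume

open Summit.ABC.IUTFork Summit.ABC.IUTFork.Thm311.Real Literature.NumberTheory.NumberFields

namespace ThetaVolumeInput

variable {F₀ : Type} [Field F₀] [NumberField F₀] {K : Type} [Field K] [NumberField K] [Algebra F₀ K]
variable (I : ThetaVolumeInput F₀ K)

/-- **`Σ_{p∈T(I)} ln ν̄_{𝕃_p}((U)-region over print's (Ind2)) = −ndegLgpSlotMin(P_Θ; T(I))`** — ANY `[F₀ : ℚ]`: over a print-dominated `H` the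
Θ-side of reading (U) is the LEAST-SLOT aggregate of abc-iut-S8's `PilotSlotResidue.lean` (idele norms = slot values, abc-iut-s2-p2's
`log_norm_tΘ_eq_neg_slotValue`). [cite: Mochizuki2012, IUTchIII Cor. 3.12 p. 174] [cite: DupuyHilado2025, Def. 3.6.3, §4.7, §4.11–4.12]
[claim: Mochizuki2012, status: disputed] -/
theorem sum_lnνLp_hull_printInd2_union_eq_neg_ndegLgpSlotMin
    (H : (p : ℕ) → (hp : p.Prime) → (j : ℕ) → (e : Fin (j + 1) → placesOver F₀ p) →
      haveI : Fact p.Prime := ⟨hp⟩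
      Subgroup (PacketAlgebra p (fun b => (I.σ.localFields p).k (e b)) ≃ₗ[ℚ_[p]]
        PacketAlgebra p (fun b => (I.σ.localFields p).k (e b))))
    (hH : ∀ (p : ℕ) (hp : p.Prime), haveI : Fact p.Prime := ⟨hp⟩
      ∀ j e, ∀ g ∈ H p hp j e,
        ∃ ψ : ∀ b : Fin (j + 1), Carrier (.inr (I.σ.lift (e b).1) : Thm311.Real.Place K) ≃ₗ[ℚ]
            Carrier (.inr (I.σ.lift (e b).1) : Thm311.Real.Place K),
          (∀ b, ψ b ∈ ismIsm (analyticLogv K) (I.σ.lift (e b).1)) ∧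
          ∀ x : ∀ b, (I.σ.localFields p).k (e b),
            (g : PacketAlgebra p (fun b => (I.σ.localFields p).k (e b)) ≃ₗ[ℚ_[p]]
                PacketAlgebra p (fun b => (I.σ.localFields p).k (e b))) (PiTensorProduct.tprod ℚ_[p] x) =
              PiTensorProduct.tprod ℚ_[p] (fun b =>
                RescaledCompletion.of K p (I.σ.lift (e b).1) (I.σ.natCast_mem_lift (e b))
                  (ψ b ((RescaledCompletion.of K p (I.σ.lift (e b).1) (I.σ.natCast_mem_lift (e b))).symm (x b))))) :
    (∑ p ∈ I.supportPrimes,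
        if hp : p.Prime then
          (haveI : Fact p.Prime := ⟨hp⟩
           (I.packetAt p hp).lnνLp I.lstar (fun j e =>
             packetHull p (fun b => (I.σ.localFields p).k (e b))
               (⋃ g : H p hp j e, (g : PacketAlgebra p (fun b => (I.σ.localFields p).k (e b)) ≃ₗ[ℚ_[p]]
                   PacketAlgebra p (fun b => (I.σ.localFields p).k (e b))) ''
                 ⋃ τ : Equiv.Perm (Fin (j + 1)), (I.packetAt p hp).perm τ e ''
                   (I.packetAt p hp).pilotRegion (I.tΘ p hp) j (e ∘ τ))))
        else 0) =
      -I.X.ndegLgpSlotMin I.supportPrimes := by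
  unfold PilotData.ndegLgpSlotMin
  rw [← Finset.sum_neg_distrib]
  refine Finset.sum_congr rfl fun p hpT => ?_
  have hp : p.Prime := I.prime_of_mem_supportPrimes hpT
  rw [dif_pos hp]
  haveI : Fact p.Prime := ⟨hp⟩
  exact localFields_lnνLp_hull_printInd2_slotUnion_eq_neg_slotMin I.σ p (mScale p (I.σ.localFields p))
    (mScale_ne_zero p (I.σ.localFields p)) (mScale_perm p (I.σ.localFields p)) (I.tΘ p hp)
    (fun i v => I.X.slotValue i v.1) (fun i v => I.log_norm_tΘ_eq_neg_slotValue p i v) (H p hp) (hH p hp)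

/-- **… = `−deĝ̲_lgp(P_Θ) + slotResidue(P_Θ; T(I))`** (abc-iut-S8's `slotResidue = ndegLgpOn − ndegLgpSlotMin` and `DHData.ndegLgpOn_eq_ndegLgp`,
Dupuy–Hilado Thm. 3.10.1): reading (U) over print's (Ind2) gains EXACTLY the (Ind1) slot residue over reading (P) (part 2: `−deĝ̲_lgp(P_Θ)`).
[cite: Mochizuki2012, IUTchIII Cor. 3.12 p. 174; proof Step (x) p. 181] [cite: DupuyHilado2025, §4.7, Thm. 3.10.1] [claim: Mochizuki2012, status: disputed] -/
theorem sum_lnνLp_hull_printInd2_union_eq_neg_ndegLgp_add_slotResidue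
    (H : (p : ℕ) → (hp : p.Prime) → (j : ℕ) → (e : Fin (j + 1) → placesOver F₀ p) →
      haveI : Fact p.Prime := ⟨hp⟩
      Subgroup (PacketAlgebra p (fun b => (I.σ.localFields p).k (e b)) ≃ₗ[ℚ_[p]]
        PacketAlgebra p (fun b => (I.σ.localFields p).k (e b))))
    (hH : ∀ (p : ℕ) (hp : p.Prime), haveI : Fact p.Prime := ⟨hp⟩
      ∀ j e, ∀ g ∈ H p hp j e,
        ∃ ψ : ∀ b : Fin (j + 1), Carrier (.inr (I.σ.lift (e b).1) : Thm311.Real.Place K) ≃ₗ[ℚ]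
            Carrier (.inr (I.σ.lift (e b).1) : Thm311.Real.Place K),
          (∀ b, ψ b ∈ ismIsm (analyticLogv K) (I.σ.lift (e b).1)) ∧
          ∀ x : ∀ b, (I.σ.localFields p).k (e b),
            (g : PacketAlgebra p (fun b => (I.σ.localFields p).k (e b)) ≃ₗ[ℚ_[p]]
                PacketAlgebra p (fun b => (I.σ.localFields p).k (e b))) (PiTensorProduct.tprod ℚ_[p] x) =
              PiTensorProduct.tprod ℚ_[p] (fun b =>
                RescaledCompletion.of K p (I.σ.lift (e b).1) (I.σ.natCast_mem_lift (e b))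
                  (ψ b ((RescaledCompletion.of K p (I.σ.lift (e b).1) (I.σ.natCast_mem_lift (e b))).symm (x b))))) :
    (∑ p ∈ I.supportPrimes,
        if hp : p.Prime then
          (haveI : Fact p.Prime := ⟨hp⟩
           (I.packetAt p hp).lnνLp I.lstar (fun j e =>
             packetHull p (fun b => (I.σ.localFields p).k (e b))
               (⋃ g : H p hp j e, (g : PacketAlgebra p (fun b => (I.σ.localFields p).k (e b)) ≃ₗ[ℚ_[p]]
                   PacketAlgebra p (fun b => (I.σ.localFields p).k (e b))) ''
                 ⋃ τ : Equiv.Perm (Fin (j + 1)), (I.packetAt p hp).perm τ e ''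
                   (I.packetAt p hp).pilotRegion (I.tΘ p hp) j (e ∘ τ))))
        else 0) =
      -LgpDivisor.ndegLgp I.X.thetaPilot + I.X.slotResidue I.supportPrimes := by
  have h2 : I.X.ndegLgpOn I.supportPrimes = LgpDivisor.ndegLgp I.X.thetaPilot := (DHData.ofInput I).ndegLgpOn_eq_ndegLgp
  rw [I.sum_lnνLp_hull_printInd2_union_eq_neg_ndegLgpSlotMin H hH, PilotData.slotResidue, h2]
  ring

/-- **THE CRITERION, ANY `[F_mod : ℚ]`: reading (U) over PRINT's (Ind2) holds IFF `deĝ̲_lgp(P_Θ) − deĝ̲(P_q) − slotResidue(P_Θ; T(I)) ≤ ((l+5)/4)·log π`**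
(the inline HYPOTHESIS `−|log(q)| ≤ [(U)-Θ-side over H] + ((l+5)/4)·log π` on the left). For `[F₀ : ℚ] = 1` the residue vanishes and this is part 7's
`union_printInd2_iff_gap_le_arch_of_finrank_eq_one`. [cite: Mochizuki2012, IUTchIII Cor. 3.12 p. 174] [cite: Mochizuki2012, IUTchIV Thm. 1.10 Steps (v)–(viii)
p. 27–31] [cite: DupuyHilado2025, §4.7, §4.11, §4.12] [claim: Mochizuki2012, status: disputed] -/
theorem union_printInd2_iff_gap_sub_slotResidue_le_arch
    (H : (p : ℕ) → (hp : p.Prime) → (j : ℕ) → (e : Fin (j + 1) → placesOver F₀ p) →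
      haveI : Fact p.Prime := ⟨hp⟩
      Subgroup (PacketAlgebra p (fun b => (I.σ.localFields p).k (e b)) ≃ₗ[ℚ_[p]]
        PacketAlgebra p (fun b => (I.σ.localFields p).k (e b))))
    (hH : ∀ (p : ℕ) (hp : p.Prime), haveI : Fact p.Prime := ⟨hp⟩
      ∀ j e, ∀ g ∈ H p hp j e,
        ∃ ψ : ∀ b : Fin (j + 1), Carrier (.inr (I.σ.lift (e b).1) : Thm311.Real.Place K) ≃ₗ[ℚ]
            Carrier (.inr (I.σ.lift (e b).1) : Thm311.Real.Place K),
          (∀ b, ψ b ∈ ismIsm (analyticLogv K) (I.σ.lift (e b).1)) ∧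
          ∀ x : ∀ b, (I.σ.localFields p).k (e b),
            (g : PacketAlgebra p (fun b => (I.σ.localFields p).k (e b)) ≃ₗ[ℚ_[p]]
                PacketAlgebra p (fun b => (I.σ.localFields p).k (e b))) (PiTensorProduct.tprod ℚ_[p] x) =
              PiTensorProduct.tprod ℚ_[p] (fun b =>
                RescaledCompletion.of K p (I.σ.lift (e b).1) (I.σ.natCast_mem_lift (e b))
                  (ψ b ((RescaledCompletion.of K p (I.σ.lift (e b).1) (I.σ.natCast_mem_lift (e b))).symm (x b))))) :
    (I.negAbsLogQ ≤
      (∑ p ∈ I.supportPrimes,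
        if hp : p.Prime then
          (haveI : Fact p.Prime := ⟨hp⟩
           (I.packetAt p hp).lnνLp I.lstar (fun j e =>
             packetHull p (fun b => (I.σ.localFields p).k (e b))
               (⋃ g : H p hp j e, (g : PacketAlgebra p (fun b => (I.σ.localFields p).k (e b)) ≃ₗ[ℚ_[p]]
                   PacketAlgebra p (fun b => (I.σ.localFields p).k (e b))) ''
                 ⋃ τ : Equiv.Perm (Fin (j + 1)), (I.packetAt p hp).perm τ e ''
                   (I.packetAt p hp).pilotRegion (I.tΘ p hp) j (e ∘ τ))))
        else 0) + archLogTheta I.l) ↔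
      LgpDivisor.ndegLgp I.X.thetaPilot - FinDivisor.ndeg F₀ I.X.qPilot - I.X.slotResidue I.supportPrimes ≤ archLogTheta I.l := by
  rw [I.sum_lnνLp_hull_printInd2_union_eq_neg_ndegLgp_add_slotResidue H hH]
  unfold negAbsLogQ
  constructor <;> intro h <;> linarith

end ThetaVolumeInput

/-! ## 4. At a genuine Θ-volume datum of a `λ`-line point: the deciding inequality, any `d_mod` -/

namespace Cor22

namespace ThetaVolumeDatumAt

open Literature.NumberTheory.DiophantineGeometry.GenEll

variable {P : NFPoint} {l : ℕ} (T : ThetaVolumeDatumAt P l)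

/-- **DECIDING INEQUALITY FOR READING (U) OVER PRINT's (Ind2) at a genuine datum of `(P, l)`, `λ_P ∈ U`, ANY `d_mod`**: for every print-dominated `H`
the union inequality holds IFF `((l+1)/24 − 1/(2l))·log q^{∤{2,l}}(λ_P) − slotResidue(T) ≤ ((l+5)/4)·log π`, where `slotResidue(T)` is abc-iut-S8's (Ind1)
slot residue of the datum's pilot data `(j_E, 𝕍^bad_mod, l)` over `F_mod` on its support primes (`0` when `F_mod` has one place over each of them,
e.g. rational `j`; positive at a support prime carrying places with theta values of unequal size). [cite: Mochizuki2012, IUTchIII Cor. 3.12 p. 174]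
[cite: Mochizuki2012, IUTchIV Thm. 1.10 Step (v) p. 27–28, Step (viii) p. 30] [cite: DupuyHilado2025, §4.7, §4.11, §4.12] [claim: Mochizuki2012, status: disputed] -/
theorem union_printInd2_iff_shallow_sub_slotResidue (hU : P.InU) :
    letI := T.instFieldF; letI := T.instNumberFieldF; letI := T.instFieldK; letI := T.instNumberFieldK
    letI := T.instAlgebraK; letI := T.instIsElliptic
    ∀ (H : (p : ℕ) → (hp : p.Prime) → (j : ℕ) →
        (e : Fin (j + 1) → placesOver (Literature.IUT.HodgeTheaters.fieldOfModuli T.E) p) →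
        haveI : Fact p.Prime := ⟨hp⟩
        Subgroup (PacketAlgebra p (fun b => (T.I.σ.localFields p).k (e b)) ≃ₗ[ℚ_[p]]
          PacketAlgebra p (fun b => (T.I.σ.localFields p).k (e b)))),
      (∀ (p : ℕ) (hp : p.Prime), haveI : Fact p.Prime := ⟨hp⟩
        ∀ j e, ∀ g ∈ H p hp j e,
          ∃ ψ : ∀ b : Fin (j + 1), Carrier (.inr (T.I.σ.lift (e b).1) : Thm311.Real.Place T.K) ≃ₗ[ℚ]
              Carrier (.inr (T.I.σ.lift (e b).1) : Thm311.Real.Place T.K),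
            (∀ b, ψ b ∈ ismIsm (analyticLogv T.K) (T.I.σ.lift (e b).1)) ∧
            ∀ x : ∀ b, (T.I.σ.localFields p).k (e b),
              (g : PacketAlgebra p (fun b => (T.I.σ.localFields p).k (e b)) ≃ₗ[ℚ_[p]]
                  PacketAlgebra p (fun b => (T.I.σ.localFields p).k (e b))) (PiTensorProduct.tprod ℚ_[p] x) =
                PiTensorProduct.tprod ℚ_[p] (fun b =>
                  RescaledCompletion.of T.K p (T.I.σ.lift (e b).1) (T.I.σ.natCast_mem_lift (e b))
                    (ψ b ((RescaledCompletion.of T.K p (T.I.σ.lift (e b).1) (T.I.σ.natCast_mem_lift (e b))).symm (x b))))) →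
      ((T.negAbsLogQ ≤
          (∑ p ∈ T.I.supportPrimes,
            if hp : p.Prime then
              (haveI : Fact p.Prime := ⟨hp⟩
               (T.I.packetAt p hp).lnνLp T.I.lstar (fun j e =>
                 packetHull p (fun b => (T.I.σ.localFields p).k (e b))
                   (⋃ g : H p hp j e, (g : PacketAlgebra p (fun b => (T.I.σ.localFields p).k (e b)) ≃ₗ[ℚ_[p]]
                       PacketAlgebra p (fun b => (T.I.σ.localFields p).k (e b))) ''
                     ⋃ τ : Equiv.Perm (Fin (j + 1)), (T.I.packetAt p hp).perm τ e ''
                       (T.I.packetAt p hp).pilotRegion (T.I.tΘ p hp) j (e ∘ τ))))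
            else 0) + ThetaVolumeInput.archLogTheta l) ↔
        (((l : ℝ) + 1) / 24 - 1 / (2 * l)) * logQAvoid P {2, l} - T.I.X.slotResidue T.I.supportPrimes ≤
          ((l : ℝ) + 5) / 4 * Real.log Real.pi) := by
  letI := T.instFieldF; letI := T.instNumberFieldF; letI := T.instFieldK; letI := T.instNumberFieldK
  letI := T.instAlgebraK; letI := T.instIsElliptic
  intro H hH
  have hl' : ThetaVolumeInput.archLogTheta T.I.l = ThetaVolumeInput.archLogTheta l := by rw [T.l_eq]
  have harch : ThetaVolumeInput.archLogTheta l = ((l : ℝ) + 5) / 4 * Real.log Real.pi := rfl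
  have hg : T.gap = LgpDivisor.ndegLgp T.I.X.thetaPilot - FinDivisor.ndeg _ T.I.X.qPilot := rfl
  have key := T.I.union_printInd2_iff_gap_sub_slotResidue_le_arch H hH
  rw [hl', ← hg, PointDict.gap_eq T hU, harch] at key
  exact key

end ThetaVolumeDatumAt

end Cor22

end Literature.IUT.LogVolume

end
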